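import Literature.NumberTheory.LFunctions.Zhang2022.KnifeEdgeLenZDegreeShort
import Literature.NumberTheory.LFunctions.Zhang2022.KnifeEdgeLenZDegreePack

/-!
# Zhang (2022), rung F-S3 (Landau–Siegel programme, §D edge len = E*-len⁺): route `ZDegreeToeplitzBand`, the packaged
# crux of the ψ-graded line RESTRICTED TO A PAIR CLASS — tables demanded on a class `𝒞` only, closing witnessed inside
# `𝒞` — and its glue to Theorem 1 (PROVED; nothing asserted)

Y. Zhang, *Discrete mean estimates and the Landau–Siegel zero*, arXiv:2211.02515v1 [Zhang2022LandauSiegel] — an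
unrefereed manuscript under adjudication. **WHAT THIS IS NOT: not a claim about Theorems 1–2 of arXiv:2211.02515, about
Landau–Siegel zeros, or about Parity. The programme SEARCHES and TYPES; no claim about Landau–Siegel zeros, Theorems 1–2
of arXiv:2211.02515 or a repaired Margin232 until a kernel theorem says so.** `GradedClosesOn 𝒞 X₁ Y₁ X₂` and
`GradedClosesPsiOn c′ 𝒞` are predicates (statement SHAPES asserted by no one); every `theorem` here is an implication
between shapes, or finite bookkeeping over the tree's ψ-graded slots.

CONTENT (authored by the cell's refuter ls-ref-1 g5 as the scratch file `GradedClosesPsiOn.lean` sha16 2c8b9a734af0243e,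
REF input to the route's D-0014 class call, 2026-08-27; landed verbatim in content by ls-Bfam-typer-1 g4 on the lead's word,
with docstrings and provenance tags added). The claim it makes checkable by name: the pack theorem
`KnifeEdge.notAEventually_of_gradedClosesPsi` (`KnifeEdgeLenZDegreePack`) evaluates the three tables ONLY at the witness
design's three pairs `(f,g₁)` [X₁], `(f,g₂)` [X₂], `(g₁,g₂)` [Y₁]; hence tables typed on a pair class `𝒞` (the restricted
slots `KnifeEdge.CrossTablePsiOn` / `DualCrossTablePsiOn` of `KnifeEdgeLenZDegreeShort`, e.g. on the half-class
`KnifeEdge.ShortPairs`) plus a closing design whose three pairs lie in `𝒞` already give «(A) fails eventually» and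
Theorem 1 verbatim. So a half-class instance is NOT a narrowing of the route's terminal: it restates K1 weaker (tables on
`𝒞` only) and K2/α3 stronger (the closing witness must be a `𝒞`-design).

* `GradedClosesOn 𝒞 X₁ Y₁ X₂` — closing witnessed by an in-class design whose three pairs lie in `𝒞`;
  `GradedClosesOn.gradedCloses` forgets the class.
* `GradedClosesPsiOn c′ 𝒞` — the packaged crux ON `𝒞`; `gradedClosesPsiOn_top_iff`: on the trivial class it is the
  tree's `GradedClosesPsi c′`.
* `gramEntryAsymp_psiOn_offdiag` / `gramEntryAsymp_psiOn` — the Gram-entry slots at a `𝒞`-design from tables ON `𝒞`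
  (the proofs of `gramEntryAsymp_psi_offdiag` / `gramEntryAsymp_psi` with the class hypothesis threaded).
* `notAEventually_of_gradedClosesPsiOn` — in-class means ∧ Prop 2.2 (i) ∧ Lemma 2.3 ∧ the package ON `𝒞` ⇒ (A) fails
  eventually; `gradedClosesPsi_of_gradedClosesPsiOn` — hence the full package; `theorem1_of_gradedClosesPsiOn_pack_eventually`
  — the closed eventually-in-`c′` glue to `Theorem1` (Part I discharged by the tree: `prop22i_holds`, `lemma23_eventually`).
* `gradedQuadForm_dark_schur_neg` — the Schur-horn computation of `gradedCloses_dark_of_schur` with the amplitudes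
  EXPLICIT, so the closing design is the given triple; `gradedClosesPsiOn_short_of_schur` — on the half-class of short pairs
  with a dark degree-2 table (`TauTwoDarkShort`) the closing test is the Schur horn alone.

No item of any route is restated here (D-0014: restating is the planner's); the planner types the class-call signatures
over these declarations.

## References
* Y. Zhang, arXiv:2211.02515v1 (2022), §1 Theorems 1–2; §2 (2.16), (2.17), p. 6; §7 Prop 7.1 (7.2); §8 (8.2), (8.5),
  Lemma 8.1. [cite: Zhang2022LandauSiegel, §1, §2 (2.16) (2.17), §7 (7.2), §8 (8.5)]
-/

noncomputable section

namespace Literature.NumberTheory.LFunctions.Zhang2022.KnifeEdge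

open Skeleton ComplexConjugate

variable {c' : ℝ} {𝒞 : PairClass} {X₁ Y₁ X₂ : PairFunctional}
variable {f f' g₁ g₁' g₂ g₂' : ℝ → ℂ}

/-! ### Part 1 — the package ON a pair class -/

/-- **Closing witnessed INSIDE the class `𝒞`:** some in-class design `(f, g₁, g₂)` whose three pairs `(f,g₁)`, `(f,g₂)`,
`(g₁,g₂)` lie in `𝒞`, and amplitudes `s`, make the graded main-term quadratic form negative. `GradedClosesOn ⊤` is the
tree's `GradedCloses` up to the trivial class witnesses. (Shape; asserted by no one.) [cite: Zhang2022LandauSiegel, §2 (2.16), §7 (7.2)] -/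
def GradedClosesOn (𝒞 : PairClass) (X₁ Y₁ X₂ : PairFunctional) : Prop :=
  ∃ (f f' g₁ g₁' g₂ g₂' : ℝ → ℂ) (s : Fin 3 → ℂ), InClassPiece f f' ∧ InClassPiece g₁ g₁' ∧ InClassPiece g₂ g₂' ∧
    𝒞 f f' g₁ g₁' ∧ 𝒞 f f' g₂ g₂' ∧ 𝒞 g₁ g₁' g₂ g₂' ∧
    gradedQuadForm (gradedMainMatrix X₁ Y₁ X₂ f f' g₁ g₁' g₂ g₂') s < 0

/-- Forgetting the class: closing inside `𝒞` is closing. [cite: Zhang2022LandauSiegel, §2 (2.16)] -/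
theorem GradedClosesOn.gradedCloses (h : GradedClosesOn 𝒞 X₁ Y₁ X₂) : GradedCloses X₁ Y₁ X₂ := by
  obtain ⟨f, f', g₁, g₁', g₂, g₂', s, hf, hg₁, hg₂, -, -, -, hneg⟩ := h
  exact ⟨f, f', g₁, g₁', g₂, g₂', s, hf, hg₁, hg₂, hneg⟩

/-- **The packaged crux ON a pair class** (shape; asserted by no one): pair functionals `X₁, Y₁, X₂` such that the
ψ-graded degree-1 cross table, the degree-1 dual table and the degree-2 cross table hold ON `𝒞` (restricted slots
`CrossTablePsiOn` / `DualCrossTablePsiOn`) AND the closing is witnessed inside `𝒞`. Compare the tree's full package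
`GradedClosesPsi c′` (tables on all in-class pairs, witness anywhere in the class). [cite: Zhang2022LandauSiegel, §2 (2.16), §8 (8.5)] -/
def GradedClosesPsiOn (c' : ℝ) (𝒞 : PairClass) : Prop :=
  ∃ X₁ Y₁ X₂ : PairFunctional, CrossTablePsiOn c' 𝒞 1 X₁ ∧ DualCrossTablePsiOn c' 𝒞 1 Y₁ ∧ CrossTablePsiOn c' 𝒞 2 X₂ ∧
    GradedClosesOn 𝒞 X₁ Y₁ X₂

/-- On the TRIVIAL class the package ON the class is the full package `GradedClosesPsi c′`. (The full package does NOT give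
the package on every class: its closing witness need not lie in `𝒞`.) [cite: Zhang2022LandauSiegel, §2 (2.16), §8 (8.5)] -/
theorem gradedClosesPsiOn_top_iff : GradedClosesPsiOn c' (fun _ _ _ _ => True) ↔ GradedClosesPsi c' := by
  constructor
  · rintro ⟨X₁, Y₁, X₂, h1, h21, h2, hC⟩
    exact ⟨X₁, Y₁, X₂, crossTablePsiOn_top_iff.mp h1, dualCrossTablePsiOn_top_iff.mp h21, crossTablePsiOn_top_iff.mp h2,
      hC.gradedCloses⟩
  · rintro ⟨X₁, Y₁, X₂, h1, h21, h2, hC⟩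
    obtain ⟨f, f', g₁, g₁', g₂, g₂', s, hf, hg₁, hg₂, hneg⟩ := hC
    exact ⟨X₁, Y₁, X₂, crossTablePsiOn_top_iff.mpr h1, dualCrossTablePsiOn_top_iff.mpr h21, crossTablePsiOn_top_iff.mpr h2,
      f, f', g₁, g₁', g₂, g₂', s, hf, hg₁, hg₂, trivial, trivial, trivial, hneg⟩

/-! ### Part 2 — the Gram-entry slots at a `𝒞`-design from tables ON `𝒞`, and the endgame -/

/-- **Off-diagonal Gram-entry slots from tables ON `𝒞`**, at an in-class design whose three pairs lie in `𝒞` (the proof of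
`gramEntryAsymp_psi_offdiag` verbatim with the class hypothesis threaded): the degree-1 cross table gives slot `(1,0)`, the
degree-2 cross table slot `(2,0)`, the degree-1 dual table slot `(2,1)` (given Prop. 2.2 (i)).
[cite: Zhang2022LandauSiegel, §2 (2.17), §8 (8.2), (8.5)] -/
theorem gramEntryAsymp_psiOn_offdiag (h1 : CrossTablePsiOn c' 𝒞 1 X₁) (h21 : DualCrossTablePsiOn c' 𝒞 1 Y₁)
    (h2 : CrossTablePsiOn c' 𝒞 2 X₂) (h22 : Prop22i) (hf : InClassPiece f f') (hg₁ : InClassPiece g₁ g₁')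
    (hg₂ : InClassPiece g₂ g₂') (c01 : 𝒞 f f' g₁ g₁') (c02 : 𝒞 f f' g₂ g₂') (c12 : 𝒞 g₁ g₁' g₂ g₂') :
    GramEntryAsymp c' (psiPieceTable f g₁ g₂ 1) (psiPieceTable f g₁ g₂ 0)
        (gradedMainMatrix X₁ Y₁ X₂ f f' g₁ g₁' g₂ g₂' 1 0) ∧
      GramEntryAsymp c' (psiPieceTable f g₁ g₂ 2) (psiPieceTable f g₁ g₂ 0)
        (gradedMainMatrix X₁ Y₁ X₂ f f' g₁ g₁' g₂ g₂' 2 0) ∧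
      GramEntryAsymp c' (psiPieceTable f g₁ g₂ 2) (psiPieceTable f g₁ g₂ 1)
        (gradedMainMatrix X₁ Y₁ X₂ f f' g₁ g₁' g₂ g₂' 2 1) := by
  refine ⟨fun ε hε => ?_, fun ε hε => ?_, fun ε hε => ?_⟩
  · obtain ⟨D₁, hD₁⟩ := (h1 f f' g₁ g₁' hf hg₁ c01 ε hε).and h22
    refine ⟨max D₁ 3, fun D _ χ hD hq hp hA => ?_⟩
    obtain ⟨he, h22'⟩ := hD₁ D χ (le_trans (le_max_left _ _) hD) hq hp
    have hW := norm_Zpsi_eq_one_of (χ := χ) (le_trans (le_max_right _ _) hD) h22'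
    simpa [psiPieceTable, discPolar_psiGradedPiece hW, basePiece, gradedMainMatrix] using he hA
  · obtain ⟨D₁, hD₁⟩ := (h2 f f' g₂ g₂' hf hg₂ c02 ε hε).and h22
    refine ⟨max D₁ 3, fun D _ χ hD hq hp hA => ?_⟩
    obtain ⟨he, h22'⟩ := hD₁ D χ (le_trans (le_max_left _ _) hD) hq hp
    have hW := norm_Zpsi_eq_one_of (χ := χ) (le_trans (le_max_right _ _) hD) h22'
    simpa [psiPieceTable, discPolar_psiGradedPiece hW, basePiece, gradedMainMatrix] using he hA
  · obtain ⟨D₁, hD₁⟩ := (h21 g₁ g₁' g₂ g₂' hg₁ hg₂ c12 ε hε).and h22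
    refine ⟨max D₁ 3, fun D _ χ hD hq hp hA => ?_⟩
    obtain ⟨he, h22'⟩ := hD₁ D χ (le_trans (le_max_left _ _) hD) hq hp
    have hW := norm_Zpsi_eq_one_of (χ := χ) (le_trans (le_max_right _ _) hD) h22'
    simpa [psiPieceTable, discPolar_psiGradedPiece hW, basePiece, gradedMainMatrix] using he hA

/-- **All nine Gram-entry slots at a `𝒞`-design from tables ON `𝒞`** (diagonal slots from the in-class means, as in
`gramEntryAsymp_psi`; lower off-diagonal slots from `gramEntryAsymp_psiOn_offdiag`; upper by conjugate symmetry).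
[cite: Zhang2022LandauSiegel, §2 (2.16) (2.17), §8 (8.5)] -/
theorem gramEntryAsymp_psiOn (h0 : InClassMean c') (h1 : CrossTablePsiOn c' 𝒞 1 X₁) (h21 : DualCrossTablePsiOn c' 𝒞 1 Y₁)
    (h2 : CrossTablePsiOn c' 𝒞 2 X₂) (h22 : Prop22i) (hf : InClassPiece f f') (hg₁ : InClassPiece g₁ g₁')
    (hg₂ : InClassPiece g₂ g₂') (c01 : 𝒞 f f' g₁ g₁') (c02 : 𝒞 f f' g₂ g₂') (c12 : 𝒞 g₁ g₁' g₂ g₂') :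
    ∀ a b, GramEntryAsymp c' (psiPieceTable f g₁ g₂ a) (psiPieceTable f g₁ g₂ b)
      (gradedMainMatrix X₁ Y₁ X₂ f f' g₁ g₁' g₂ g₂' a b) := by
  obtain ⟨e10, e20, e21⟩ := gramEntryAsymp_psiOn_offdiag h1 h21 h2 h22 hf hg₁ hg₂ c01 c02 c12
  refine gramEntryAsymp_of_lower (gradedMainMatrix_conj_symm X₁ Y₁ X₂ f f' g₁ g₁' g₂ g₂') fun a b hba => ?_
  fin_cases a <;> fin_cases b
  · exact gramEntryAsymp_psi_diag h0 h22 hf hg₁ hg₂ 0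
  · exact absurd hba (by decide)
  · exact absurd hba (by decide)
  · exact e10
  · exact gramEntryAsymp_psi_diag h0 h22 hf hg₁ hg₂ 1
  · exact absurd hba (by decide)
  · exact e20
  · exact e21
  · exact gramEntryAsymp_psi_diag h0 h22 hf hg₁ hg₂ 2

/-- **Endgame ON a class (proved):** in-class means ∧ Prop. 2.2 (i) ∧ Lemma 2.3 at `c′` ∧ the package ON `𝒞` ⇒ (A) fails
for every real primitive character to every large modulus (the Gram endgame `eventually_not_assumptionA_of_gramSlots` on
`gramEntryAsymp_psiOn`). [cite: Zhang2022LandauSiegel, §2 p. 6, (2.16)] -/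
theorem notAEventually_of_gradedClosesPsiOn (h0 : InClassMean c') (h22 : Prop22i) (h23 : Lemma23 c')
    (hG : GradedClosesPsiOn c' 𝒞) : ForAllLarge fun D _ χ => ¬ AssumptionA D χ := by
  obtain ⟨X₁, Y₁, X₂, h1, h21, h2, hC⟩ := hG
  obtain ⟨f, f', g₁, g₁', g₂, g₂', s, hf, hg₁, hg₂, c01, c02, c12, hneg⟩ := hC
  exact eventually_not_assumptionA_of_gramSlots (gramEntryAsymp_psiOn h0 h1 h21 h2 h22 hf hg₁ hg₂ c01 c02 c12) hneg h22 h23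

/-- … hence the FULL package `GradedClosesPsi c′` (vacuous horn in the eventually-¬(A) world,
`gradedClosesPsi_of_notAEventually`), hence Theorem 1 through the existing pack. [cite: Zhang2022LandauSiegel, §2 p. 6, (2.16)] -/
theorem gradedClosesPsi_of_gradedClosesPsiOn (h0 : InClassMean c') (h22 : Prop22i) (h23 : Lemma23 c')
    (hG : GradedClosesPsiOn c' 𝒞) : GradedClosesPsi c' :=
  gradedClosesPsi_of_notAEventually (notAEventually_of_gradedClosesPsiOn h0 h22 h23 hG) c'

/-- **Closed eventually-in-`c′` form (proved):** in-class means for all large `c′` ∧ the package ON `𝒞` for all large `c′`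
⇒ Theorem 1 — Part I (`prop22i_holds`, `lemma23_eventually`) discharged by the tree; take the max of the three
thresholds. [cite: Zhang2022LandauSiegel, §1 Theorem 1, §2 p. 6] -/
theorem theorem1_of_gradedClosesPsiOn_pack_eventually (h0 : ∃ c₁ : ℝ, ∀ c' : ℝ, c₁ ≤ c' → InClassMean c')
    (h : ∃ c₂ : ℝ, ∀ c' : ℝ, c₂ ≤ c' → GradedClosesPsiOn c' 𝒞) : Theorem1 := by
  obtain ⟨c₀, -, h23⟩ := lemma23_eventually
  obtain ⟨c₁, h₁⟩ := h0
  obtain ⟨c₂, h₂⟩ := h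
  refine theorem1_of_gradedClosesPsi_pack_eventually ⟨c₁, h₁⟩ ⟨max c₀ (max c₁ c₂), fun c' hc' => ?_⟩
  have hc0 : c₀ ≤ c' := le_trans (le_max_left _ _) hc'
  have hc1 : c₁ ≤ c' := le_trans (le_trans (le_max_left _ _) (le_max_right _ _)) hc'
  have hc2 : c₂ ≤ c' := le_trans (le_trans (le_max_right _ _) (le_max_right _ _)) hc'
  exact gradedClosesPsi_of_gradedClosesPsiOn (h₁ c' hc1) prop22i_holds (h23 c' hc0) (h₂ c' hc2)

/-! ### Part 3 — the Schur horn with explicit amplitudes; the half-class of short pairs -/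

/-- **The Schur-horn computation of `gradedCloses_dark_of_schur` with its amplitudes EXPLICIT** (so the closing design is
the GIVEN triple): at `X₂ = 0`, if `𝔅(f), 𝔅(g₂) > 0` and `𝔅(g₁) < |X₁(f,g₁)|²/𝔅(f) + |Y₁(g₁,g₂)|²/𝔅(g₂)`, the amplitudes
`s = (−X₁/𝔅(f), 1, −conj Y₁/𝔅(g₂))` give the form value `𝔅(g₁) − |X₁|²/𝔅(f) − |Y₁|²/𝔅(g₂) < 0`.
[cite: Zhang2022LandauSiegel, §2 (2.16), §7 Prop 7.1 (7.2)] -/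
theorem gradedQuadForm_dark_schur_neg (hB0 : 0 < mainTermForm f f') (hB2 : 0 < mainTermForm g₂ g₂')
    (hlt : mainTermForm g₁ g₁' < ‖X₁ f f' g₁ g₁'‖ ^ 2 / mainTermForm f f' + ‖Y₁ g₁ g₁' g₂ g₂'‖ ^ 2 / mainTermForm g₂ g₂') :
    gradedQuadForm (gradedMainMatrix X₁ Y₁ 0 f f' g₁ g₁' g₂ g₂')
      ![-X₁ f f' g₁ g₁' / (mainTermForm f f' : ℂ), 1, -conj (Y₁ g₁ g₁' g₂ g₂') / (mainTermForm g₂ g₂' : ℂ)] < 0 := by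
  set B0 := mainTermForm f f' with hB0_def
  set B2 := mainTermForm g₂ g₂' with hB2_def
  set X := X₁ f f' g₁ g₁' with hX_def
  set Y := Y₁ g₁ g₁' g₂ g₂' with hY_def
  rw [gradedQuadForm_dark]
  simp only [Matrix.cons_val_zero, Matrix.cons_val_one, Matrix.head_cons, Matrix.cons_val_two, Matrix.tail_cons,
    one_mul, norm_one, one_pow, mul_one]
  have hB0' : (B0 : ℂ) ≠ 0 := by exact_mod_cast hB0.ne'
  have hB2' : (B2 : ℂ) ≠ 0 := by exact_mod_cast hB2.ne'
  have n0 : ‖-X / (B0 : ℂ)‖ ^ 2 = ‖X‖ ^ 2 / B0 ^ 2 := by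
    rw [norm_div, norm_neg, Complex.norm_real, Real.norm_of_nonneg hB0.le, div_pow]
  have n2 : ‖-conj Y / (B2 : ℂ)‖ ^ 2 = ‖Y‖ ^ 2 / B2 ^ 2 := by
    rw [norm_div, norm_neg, Complex.norm_conj, Complex.norm_real, Real.norm_of_nonneg hB2.le, div_pow]
  have r0 : (-X / (B0 : ℂ) * conj X).re = -(‖X‖ ^ 2 / B0) := by
    have : -X / (B0 : ℂ) * conj X = (((-(‖X‖ ^ 2 / B0)) : ℝ) : ℂ) := by
      push_cast
      rw [← Complex.mul_conj']
      field_simp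
    rw [this, Complex.ofReal_re]
  have r2 : (conj (-conj Y / (B2 : ℂ) * Y)).re = -(‖Y‖ ^ 2 / B2) := by
    rw [Complex.conj_re]
    have : -conj Y / (B2 : ℂ) * Y = (((-(‖Y‖ ^ 2 / B2)) : ℝ) : ℂ) := by
      push_cast
      rw [← Complex.mul_conj']
      field_simp
    rw [this, Complex.ofReal_re]
  rw [n0, n2, r0, r2]
  have e0 : B0 * (‖X‖ ^ 2 / B0 ^ 2) = ‖X‖ ^ 2 / B0 := by field_simp
  have e2 : B2 * (‖Y‖ ^ 2 / B2 ^ 2) = ‖Y‖ ^ 2 / B2 := by field_simp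
  rw [e0, e2]
  linarith

/-- **On the half-class of SHORT PAIRS with a DARK degree-2 table** (the K1″a hand's intended instance: `x₂ = []`
«derived = 0»): degree-1 tables ON `ShortPairs` ∧ `TauTwoDarkShort c′` ∧ an in-class triple whose three pairs are short
pairs violating the tridiagonal Schur bound (`𝔅(f), 𝔅(g₂) > 0`, `𝔅(g₁) < |X₁|²/𝔅(f) + |Y₁|²/𝔅(g₂)`) ⇒ the package ON
`ShortPairs` — hence Theorem 1 by `theorem1_of_gradedClosesPsiOn_pack_eventually`. On the half-class the closing test is the
Schur horn ALONE. [cite: Zhang2022LandauSiegel, §2 (2.16), §7 (7.2), §8 (8.5) Lemma 8.1] -/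
theorem gradedClosesPsiOn_short_of_schur (h1 : CrossTablePsiOn c' ShortPairs 1 X₁)
    (h21 : DualCrossTablePsiOn c' ShortPairs 1 Y₁) (h2 : TauTwoDarkShort c') (hf : InClassPiece f f')
    (hg₁ : InClassPiece g₁ g₁') (hg₂ : InClassPiece g₂ g₂') (c01 : ShortPairs f f' g₁ g₁') (c02 : ShortPairs f f' g₂ g₂')
    (c12 : ShortPairs g₁ g₁' g₂ g₂') (hB0 : 0 < mainTermForm f f') (hB2 : 0 < mainTermForm g₂ g₂')
    (hlt : mainTermForm g₁ g₁' < ‖X₁ f f' g₁ g₁'‖ ^ 2 / mainTermForm f f' + ‖Y₁ g₁ g₁' g₂ g₂'‖ ^ 2 / mainTermForm g₂ g₂') :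
    GradedClosesPsiOn c' ShortPairs :=
  ⟨X₁, Y₁, 0, h1, h21, h2, f, f', g₁, g₁', g₂, g₂', _, hf, hg₁, hg₂, c01, c02, c12, gradedQuadForm_dark_schur_neg hB0 hB2 hlt⟩

end Literature.NumberTheory.LFunctions.Zhang2022.KnifeEdge

end
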